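import Literature.AnabelianGeometry.EtaleTheta.Discharge.Sec5OfQuotientTemperoid
import Literature.AnabelianGeometry.SemiGraphs.TemperedDecompositionCompact

/-!
# [EtTh] §4 setting over `B^temp(G)⁰` for a homomorphism `φ : Π^tp_X → G` with DENSE image — and over the CLOSURE OF THE IMAGE of an
# ARBITRARY continuous `φ` (Def. 4.1 pp.312–313, §5 p.330 / PDF pp.86–87, 104)

Mochizuki, *The étale theta function …*, Publ. RIMS **45** (2009) [cite: MochizukiEtTh2009, Def 4.1 p.312–313 (PDF pp.86–87); §5 p.330 (PDF p.104)];
Mochizuki, *Semi-graphs of anabelioids*, Publ. RIMS **42** (2006), Def. 3.1 (i) p.33 (tempered groups; closed subgroups), Rmk. 3.1.2–3.1.3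
pp.33–34 [cite: MochizukiSemiAnbd2006, Rmk 3.1.3 p.34].  PAGE CONVENTION for [EtTh]: «printed N (PDF p.M)», N = M + 226.

abc-iut cell, layer L2, seat abc-iut-L2-t3 (gen 10; [EtTh] §3/§4 lineage), lane «DENSE-QUOTIENT» = step (α) of the repair of census item S2
(`HOME/staging/L2/L2-t3/g10/JUNCTION-CENSUS-FourthModel-L2t3g10.md`; abc-iut-L2-lead R1208/R1225).  ADDITIVE generalisation of gen 9's
`Discharge/Sec5OfQuotientTemperoid.lean` (p496572): nothing landed is edited; at a SURJECTIVE `φ` the new setting IS the old one (`rfl`).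

WHY.  Every §4/§5 junction file over the fourth tower model (p496572 / p497260 / p501267 / p501897 / p504077) displays «`φ : Π^tp_X̲̲ ↠ Compat₃′`
ONTO».  For the genuine `φ = ((κ_ϖ, κ_Ü, κ_Θ̈), χ, γ)` this is FALSE IN SHAPE (abc-iut-L2-lead R1257, finding of record): `χ(G_K) ≤ Ẑˣ` is closed of
infinite index, so the Def. 4.1 (ii) homomorphisms `Π^tp_X → Aut(Compat₃′/M) = Compat₃′/M` are not surjective.  Def. 4.1 (ii) only needs `Π^tp_X`
to SURJECT ONTO EVERY DISCRETE GALOIS QUOTIENT, which holds as soon as `φ` has DENSE image (an open coset meets a dense set); and replacing `G`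
by the CLOSURE OF THE IMAGE (closed ⇒ tempered, abc-iut-L3's `IsTempered.subgroup_of_isClosed`) makes density AUTOMATIC for every continuous `φ`.
* §0 `exists_inv_mul_apply_mem_of_denseRange` (a dense-range map meets every open coset), `MonoidHom.surjective_comp_of_denseRange`.
* §1 **`BiKummerSetting.mkOfDenseQuotientTemperoid X hG φ hφ tf …`** (`hφ : DenseRange φ`): abc-iut-L2-t9's `mkOfModelCanonical` over `B^temp(G)⁰`
  with `galoisSurj A := galoisSurjOf⁰_A ∘ φ`, surjective by §0; laws `GaloisSurjNatural` (inner conjugator `c ∈ G` of abc-iut-w5-d013's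
  `galoisSurjOf_natural` replaced by `c' ∈ Π^tp_X` with `φ c' ∈ c · Ker`), `IsOpenKerGaloisSurj`, (L1), `H_⊙ = φ⁻¹(Stab)`, `Ker φ ≤ H_⊙`;
  DICTIONARY `mkOfDenseQuotientTemperoid_eq_of_surjective`: at an onto `φ` it IS gen 9's `mkOfQuotientTemperoid` (`rfl`; onto ⇒ dense is a drop-in).
* §2 `mkOfDenseQuotientTemperoidQuot … M` (`A_⊙ := (G/M, 0)`), **`H_⊙ = φ⁻¹(M)`**, the §5 binder `hH` whenever `φ(ιX(Π^tp_Ÿ)) ⊆ M`.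
* §3 **the closure of the image**: `closureRange φ` (closed; `isTempered_closureRange`), the corestriction `toClosureRange φ : Π^tp_X →ₜ* closureRange φ`
  with `denseRange_toClosureRange` (NO hypothesis), and **`mkOfClosureRange X hG φ tf …`**: the §4 setting over `B^temp(closure(Im φ))⁰` for an
  ARBITRARY continuous `φ : Π^tp_X → G` into a tempered group — naturality, open kernels, `Ker φ ≤ H_⊙ = φ⁻¹(M)` THEOREMS; ENTRY
  `exists_biKummerSetting_closureRange`.
WHAT REMAINS at `G := Compat₃′` (lane (β) «COMAP-TOWER@CLOSED-SUBGROUP», separate files): the Def. 3.6 (ii) tower model over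
`B^temp(closure(Im φ))⁰` — here `tf` over that base is a PARAMETER — and the Kummer-class CONSTRUCTION of the genuine `φ` (§1/§2 lineages).
HONEST FRAMING: constructions and kernel-checked implications over abc-iut-L2-t3's / abc-iut-L3's data structures; [EtTh]/[SemiAnbd] are refereed
prerequisite papers; nothing here takes a side on the disputed [IUTchIII] Cor. 3.12; nothing here asserts abc proved or refuted; typed ≠ proved.
-/

noncomputable section

namespace Literature.AnabelianGeometry.EtaleTheta

open CategoryTheory Opposite Topology Literature.AlgebraicGeometry.Frobenioids Literature.AnabelianGeometry.SemiGraphs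
  Literature.AnabelianGeometry.SemiGraphs.GaloisObjects Literature.AlgebraicGeometry.Frobenioids.QuasiTemperoid.BTempConnected

universe u₀ v₀ u w

/-! ## §0 Dense range against open cosets and open-kernel surjections -/

section DenseRange

variable {P : Type*} {G : Type u} [Group G] [TopologicalSpace G] [IsTopologicalGroup G] {φ : P → G}

/-- A map with dense range meets every open left coset: for `U ≤ G` open and `c ∈ G` there is `p` with `c⁻¹ · φ(p) ∈ U`.
[cite: MochizukiSemiAnbd2006, Rmk 3.1.3 p.34] -/
theorem exists_inv_mul_apply_mem_of_denseRange (hφ : DenseRange φ) (U : Subgroup G) (hU : IsOpen (U : Set G)) (c : G) :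
    ∃ p, c⁻¹ * φ p ∈ U := by
  have ho : IsOpen ((fun x : G => c⁻¹ * x) ⁻¹' (U : Set G)) := hU.preimage (continuous_const.mul continuous_id)
  obtain ⟨p, hp⟩ := hφ.exists_mem_open ho ⟨c, by simp [U.one_mem]⟩
  exact ⟨p, hp⟩

/-- **A surjection with OPEN kernel stays surjective after precomposition with a dense-range homomorphism** (every fibre is an open coset,
which meets the dense image). [cite: MochizukiSemiAnbd2006, Rmk 3.1.3 p.34] -/
theorem MonoidHom.surjective_comp_of_denseRange {P : Type*} [Group P] {Q : Type*} [Group Q] (f : G →* Q)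
    (hf : Function.Surjective f) (hker : IsOpen (f.ker : Set G)) (φ : P →* G) (hφ : DenseRange φ) :
    Function.Surjective (f.comp φ) := by
  intro q
  obtain ⟨g, rfl⟩ := hf q
  obtain ⟨p, hp⟩ := exists_inv_mul_apply_mem_of_denseRange hφ f.ker hker g
  refine ⟨p, ?_⟩
  rw [MonoidHom.mem_ker, map_mul, map_inv, inv_mul_eq_one] at hp
  exact hp.symm

end DenseRange

/-! ## §1 The §4 setting over `B^temp(G)⁰` for a DENSE-range `φ : Π^tp_X → G` -/

namespace BiKummerSetting

variable {K : Type u₀} [Field K] (X : SemiGraphs.TemperedArithmeticGroup.{u₀} K)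
  {G : Type u} [Group G] [TopologicalSpace G] [IsTopologicalGroup G] (hG : IsTempered G)
  (φ : X.Pi →ₜ* G) (hφ : DenseRange φ)
  {D₀ : Type u₀} [Category.{v₀} D₀] {V : FrdIMonoidStub.{w}} {T₀ : RealifiedDivisorMonoids (D₀ := D₀) V}
  {VD : FrdICatStub.{u + 1, u, w} (ConnectedPart (BTemp G))}
  (tf : TemperedFrobenioid T₀ (ConnectedPart (BTemp G)) VD) (hZ : tf.monoidType = MonoidType.Z)
  (hP : ∀ A : (ConnectedPart (BTemp G))ᵒᵖ, IsPerfect (tf.Φ.carrier A))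
  (NH : Subgroup (Field.absoluteGaloisGroup K) → tf.category → ℕ+ → Prop)

section Setting

variable (A₀ : tf.category) (hA₀ : PreFrobenioid.IsFrobeniusTrivial tf.toElem A₀) (hA₀' : SemiGraphs.IsGaloisObj A₀.base.obj)

include hφ in
/-- **Def. 4.1 (ii) surjectivity from DENSITY**: for a Galois object `A` of `B^temp(G)⁰`, `galoisSurjOf⁰_A ∘ φ : Π^tp_X → Aut(A)` is
SURJECTIVE as soon as `φ` has dense image (`G ↠ Aut(A)` has open kernel, [SemiAnbd] Rmk. 3.1.3). [cite: MochizukiEtTh2009, Def 4.1 (ii) p.313 (PDF p.87)] -/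
theorem galoisSurjOf_comp_surjective_of_denseRange (A : ConnectedPart (BTemp G)) (h : SemiGraphs.IsGaloisObj A.obj) :
    Function.Surjective ((((connectedObjects (BTemp G)).fullyFaithfulι.autMulEquivOfFullyFaithful A).symm.toMonoidHom.comp
      (galoisSurjOf hG A.obj h)).comp φ.toMonoidHom) :=
  MonoidHom.surjective_comp_of_denseRange _ (galoisSurjOf_connectedPart_surjective hG A h)
    (isOpen_ker_galoisSurjOf_connectedPart hG A h) φ.toMonoidHom hφ

/-- **The §4 bi-Kummer setting over `D := B^temp(G)⁰` for a DENSE-range `φ : Π^tp_X → G`** (Def. 4.1 pp.312–313 (PDF pp.86–87)):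
abc-iut-L2-t9's `mkOfModelCanonical` with Galois objects := those whose underlying `G`-set is Galois and Galois surjections
`galoisSurjOf⁰_A ∘ φ`, surjective by density (§0). [cite: MochizukiEtTh2009, Def 4.1 p.313 (PDF p.87)] -/
def mkOfDenseQuotientTemperoid : BiKummerSetting X T₀ (ConnectedPart (BTemp G)) VD :=
  mkOfModelCanonical X tf hZ hP (fun A => SemiGraphs.IsGaloisObj A.obj)
    (fun A h => (((connectedObjects (BTemp G)).fullyFaithfulι.autMulEquivOfFullyFaithful A).symm.toMonoidHom.comp
      (galoisSurjOf hG A.obj h)).comp φ.toMonoidHom)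
    (fun A h => galoisSurjOf_comp_surjective_of_denseRange X hG φ hφ A h)
    NH A₀ hA₀ hA₀'

/-- The underlying tempered Frobenioid is `tf` (definitionally). [cite: MochizukiEtTh2009, Def 4.1 p.312 (PDF p.86)] -/
theorem mkOfDenseQuotientTemperoid_tf : (mkOfDenseQuotientTemperoid X hG φ hφ tf hZ hP NH A₀ hA₀ hA₀').tf = tf := rfl

/-- **DICTIONARY: at a SURJECTIVE `φ` the dense-range setting IS gen 9's `mkOfQuotientTemperoid`** (definitionally — the two differ only in
the PROOF of surjectivity of the Galois homomorphisms). [cite: MochizukiEtTh2009, Def 4.1 p.313 (PDF p.87)] -/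
theorem mkOfDenseQuotientTemperoid_eq_of_surjective (hφs : Function.Surjective φ) :
    mkOfDenseQuotientTemperoid X hG φ hφs.denseRange tf hZ hP NH A₀ hA₀ hA₀' =
      mkOfQuotientTemperoid X hG φ hφs tf hZ hP NH A₀ hA₀ hA₀' := rfl

/-- On underlying `G`-sets the Galois surjection at `g ∈ Π^tp_X` IS `galoisSurjOf` at `φ g` (definitionally).
[cite: MochizukiEtTh2009, Def 4.1 (ii) p.313 (PDF p.87)] -/
theorem mkOfDenseQuotientTemperoid_galoisSurj_hom_hom (A : ConnectedPart (BTemp G))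
    (hA : (mkOfDenseQuotientTemperoid X hG φ hφ tf hZ hP NH A₀ hA₀ hA₀').IsGaloisObj A) (g : X.Pi) :
    ((mkOfDenseQuotientTemperoid X hG φ hφ tf hZ hP NH A₀ hA₀ hA₀').galoisSurj A hA g).hom.hom =
      (galoisSurjOf hG A.obj hA (φ g)).hom :=
  rfl

/-- **The kernel of the setting's Galois surjection is `φ⁻¹(Ker(G ↠ Aut(A)))`.** [cite: MochizukiEtTh2009, Def 4.1 (ii) p.313 (PDF p.87)] -/
theorem ker_mkOfDenseQuotientTemperoid_galoisSurj (A : ConnectedPart (BTemp G))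
    (hA : (mkOfDenseQuotientTemperoid X hG φ hφ tf hZ hP NH A₀ hA₀ hA₀').IsGaloisObj A) :
    ((mkOfDenseQuotientTemperoid X hG φ hφ tf hZ hP NH A₀ hA₀ hA₀').galoisSurj A hA).ker =
      (galoisSurjOf hG A.obj hA).ker.comap φ.toMonoidHom := by
  ext g
  rw [MonoidHom.mem_ker, Subgroup.mem_comap, MonoidHom.mem_ker]
  change ((connectedObjects (BTemp G)).fullyFaithfulι.autMulEquivOfFullyFaithful A).symm
      (galoisSurjOf hG A.obj hA (φ g)) = 1 ↔ _
  rw [MulEquiv.map_eq_one_iff]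
  exact Iff.rfl

/-- **Def. 4.1 (ii) naturality ("natural surjective OUTER homomorphism") for a DENSE-range `φ`**: the setting satisfies
`GaloisSurjNatural` — the inner conjugator `c ∈ G` of abc-iut-w5-d013's `galoisSurjOf_natural` is replaced by any `c' ∈ Π^tp_X` with
`φ(c') ∈ c · Ker(G ↠ Aut(A))` (an open coset meets the dense image; the kernel is normal). [cite: MochizukiEtTh2009, Def 4.1 (ii) p.313 (PDF p.87)] -/
theorem mkOfDenseQuotientTemperoid_galoisSurj_natural :
    (mkOfDenseQuotientTemperoid X hG φ hφ tf hZ hP NH A₀ hA₀ hA₀').GaloisSurjNatural := by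
  intro A B hA hB b
  obtain ⟨c, hc⟩ := galoisSurjOf_connectedPart_natural hG hA hB b
  -- the Galois homomorphism `G ↠ Aut(A)` at `A` (open kernel)
  let fA : G →* Aut A := ((connectedObjects (BTemp G)).fullyFaithfulι.autMulEquivOfFullyFaithful A).symm.toMonoidHom.comp
    (galoisSurjOf hG A.obj hA)
  obtain ⟨c', hc'⟩ := exists_inv_mul_apply_mem_of_denseRange hφ fA.ker (isOpen_ker_galoisSurjOf_connectedPart hG A hA) c
  refine ⟨c', fun g => ?_⟩
  have hφc : fA (φ c') = fA c := by
    rw [MonoidHom.mem_ker, map_mul, map_inv, inv_mul_eq_one] at hc'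
    exact hc'.symm
  have key : (mkOfDenseQuotientTemperoid X hG φ hφ tf hZ hP NH A₀ hA₀ hA₀').galoisSurj A hA (c' * g * c'⁻¹) =
      fA (c * φ g * c⁻¹) := by
    change fA (φ (c' * g * c'⁻¹)) = fA (c * φ g * c⁻¹)
    rw [map_mul φ, map_mul φ, map_inv φ, map_mul fA, map_mul fA, map_inv fA, hφc, ← map_inv fA, ← map_mul fA, ← map_mul fA]
  rw [key]
  exact hc (φ g)

/-- **The kernel of `Π^tp_X → Aut(A)` is OPEN** (`φ` continuous; `IsOpenKerGaloisSurj`). [cite: MochizukiEtTh2009, Def 4.1 (ii) p.313 (PDF p.87)] -/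
theorem mkOfDenseQuotientTemperoid_isOpen_ker_galoisSurj :
    (mkOfDenseQuotientTemperoid X hG φ hφ tf hZ hP NH A₀ hA₀ hA₀').IsOpenKerGaloisSurj := by
  intro A hA
  rw [ker_mkOfDenseQuotientTemperoid_galoisSurj, Subgroup.coe_comap]
  exact (isOpen_ker_galoisSurjOf hG A.obj hA).preimage φ.continuous

/-- **Law (L1) «Galois objects are `Aut`-torsors over every target»** — independent of `φ`. [cite: MochizukiSemiAnbd2006, Rmk 3.1.3 p.34] -/
theorem mkOfDenseQuotientTemperoid_galoisHomTorsor :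
    ∀ ⦃A : ConnectedPart (BTemp G)⦄, (mkOfDenseQuotientTemperoid X hG φ hφ tf hZ hP NH A₀ hA₀ hA₀').IsGaloisObj A →
      ∀ ⦃T' : ConnectedPart (BTemp G)⦄ (b b' : A ⟶ T'), ∃ g : Aut A, b' = g.hom ≫ b :=
  fun A hA T' b b' => GaloisObjects.exists_aut_comp_eq_of_isGaloisObj_connectedPart A T' hA b b'

/-- **`H_⊙ = φ⁻¹(Stab_G(x))` for every point `x` of `A_⊙^bs`.** [cite: MochizukiEtTh2009, Def 4.1 p.312 (PDF p.86)] -/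
theorem mem_Hodot_mkOfDenseQuotientTemperoid_iff (x : A₀.base.obj.obj.V) (g : X.Pi) :
    g ∈ (mkOfDenseQuotientTemperoid X hG φ hφ tf hZ hP NH A₀ hA₀ hA₀').Hodot ↔ A₀.base.obj.obj.ρ (φ g) x = x := by
  change g ∈ ((mkOfDenseQuotientTemperoid X hG φ hφ tf hZ hP NH A₀ hA₀ hA₀').galoisSurj A₀.base hA₀').ker ↔ _
  rw [ker_mkOfDenseQuotientTemperoid_galoisSurj, Subgroup.mem_comap]
  exact mem_ker_galoisSurjOf_iff_apply hG A₀.base.obj hA₀' x (φ g)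

/-- `Ker φ ⊆ H_⊙`: the setting sees `Π^tp_X` only through `G`. [cite: MochizukiEtTh2009, Def 4.1 p.312 (PDF p.86)] -/
theorem ker_le_Hodot_mkOfDenseQuotientTemperoid :
    φ.toMonoidHom.ker ≤ (mkOfDenseQuotientTemperoid X hG φ hφ tf hZ hP NH A₀ hA₀ hA₀').Hodot := by
  intro g hg
  obtain ⟨x⟩ := nonempty_of_isConnectedObj A₀.base.obj A₀.base.property
  have hg1 : φ g = 1 := hg
  rw [mem_Hodot_mkOfDenseQuotientTemperoid_iff X hG φ hφ tf hZ hP NH A₀ hA₀ hA₀' x, hg1]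
  exact ρ_one_apply A₀.base.obj x

end Setting

/-! ## §2 The canonical `A_⊙ := (G/M, 0)` -/

section Quot

variable (M : OpenNormalSubgroup G)

/-- **The dense-range setting with `A_⊙ := (G/M, 0)`.** [cite: MochizukiEtTh2009, Def 4.1 p.312 (PDF p.86)] -/
def mkOfDenseQuotientTemperoidQuot : BiKummerSetting X T₀ (ConnectedPart (BTemp G)) VD :=
  mkOfDenseQuotientTemperoid X hG φ hφ tf hZ hP NH (tf.quotConnZeroObj hG M) (tf.isFrobeniusTrivial_quotConnZeroObj hG M)
    (tf.isGaloisObj_quotConnZeroObj_base hG M)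

/-- **`H_⊙ = φ⁻¹(M)`** (membership). [cite: MochizukiEtTh2009, Def 4.1 p.312 (PDF p.86)] -/
theorem mem_Hodot_mkOfDenseQuotientTemperoidQuot_iff (g : X.Pi) :
    g ∈ (mkOfDenseQuotientTemperoidQuot X hG φ hφ tf hZ hP NH M).Hodot ↔ φ g ∈ M := by
  rw [mkOfDenseQuotientTemperoidQuot, mem_Hodot_mkOfDenseQuotientTemperoid_iff X hG φ hφ tf hZ hP NH (tf.quotConnZeroObj hG M)
    (tf.isFrobeniusTrivial_quotConnZeroObj hG M) (tf.isGaloisObj_quotConnZeroObj_base hG M) ((1 : G) : G ⧸ M.toSubgroup) g]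
  exact quotientObj_ρ_one_eq_iff hG M.toSubgroup M.isOpen' (φ g)

/-- **`H_⊙ = φ⁻¹(M)`.** [cite: MochizukiEtTh2009, Def 4.1 p.312 (PDF p.86)] -/
theorem Hodot_mkOfDenseQuotientTemperoidQuot :
    (mkOfDenseQuotientTemperoidQuot X hG φ hφ tf hZ hP NH M).Hodot = M.toSubgroup.comap φ.toMonoidHom :=
  Subgroup.ext (mem_Hodot_mkOfDenseQuotientTemperoidQuot_iff X hG φ hφ tf hZ hP NH M)

/-- **The §5 binder `hH` (`Π^tp_Ÿ ⊆ H_⊙`) for `A_⊙ := (G/M, 0)` whenever `φ(ιX(Π^tp_Ÿ)) ⊆ M`.** [cite: MochizukiEtTh2009, §5 p.330 (PDF p.104)] -/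
theorem hH_mkOfDenseQuotientTemperoidQuot_of_forall_mem {P : Type*} [Group P] [TopologicalSpace P] (ιX : P ≃ₜ* X.Pi)
    (PiYdd : Subgroup P) (hM : ∀ y : P, y ∈ PiYdd → φ (ιX y) ∈ M) :
    ∀ y : P, y ∈ PiYdd → ιX y ∈ (mkOfDenseQuotientTemperoidQuot X hG φ hφ tf hZ hP NH M).Hodot :=
  fun y hy => (mem_Hodot_mkOfDenseQuotientTemperoidQuot_iff X hG φ hφ tf hZ hP NH M (ιX y)).2 (hM y hy)

end Quot

end BiKummerSetting

/-! ## §3 The closure of the image: NO hypothesis on `φ` -/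

section ClosureRange

variable {P : Type u₀} [Group P] [TopologicalSpace P]
  {G : Type u} [Group G] [TopologicalSpace G] [IsTopologicalGroup G] (φ : P →ₜ* G)

/-- **`closure(Im φ) ≤ G`**, a closed subgroup. [cite: MochizukiSemiAnbd2006, Def 3.1 (i) p.33] -/
def closureRange : Subgroup G := φ.toMonoidHom.range.topologicalClosure

/-- `closure(Im φ)` is closed. [cite: MochizukiSemiAnbd2006, Def 3.1 (i) p.33] -/
theorem isClosed_closureRange : IsClosed (closureRange φ : Set G) := Subgroup.isClosed_topologicalClosure _

/-- `Im φ ⊆ closure(Im φ)`. [cite: MochizukiSemiAnbd2006, Def 3.1 (i) p.33] -/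
theorem apply_mem_closureRange (p : P) : φ p ∈ closureRange φ := Subgroup.le_topologicalClosure _ ⟨p, rfl⟩

/-- **A closed subgroup of a tempered group is tempered** (abc-iut-L3's `IsTempered.subgroup_of_isClosed`): `closure(Im φ)` is tempered.
[cite: MochizukiSemiAnbd2006, Def 3.1 (i) p.33] -/
theorem isTempered_closureRange (hG : IsTempered G) : IsTempered (closureRange φ) :=
  hG.subgroup_of_isClosed _ (isClosed_closureRange φ)

/-- **The corestriction `φ : P →ₜ* closure(Im φ)`.** [cite: MochizukiSemiAnbd2006, Def 3.1 (i) p.33] -/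
def toClosureRange : P →ₜ* closureRange φ where
  toFun p := ⟨φ p, apply_mem_closureRange φ p⟩
  map_one' := Subtype.ext (map_one φ)
  map_mul' a b := Subtype.ext (map_mul φ a b)
  continuous_toFun := φ.continuous.subtype_mk _

/-- The corestriction, read back in `G` (definitionally). [cite: MochizukiSemiAnbd2006, Def 3.1 (i) p.33] -/
@[simp] theorem coe_toClosureRange_apply (p : P) : ((toClosureRange φ p : closureRange φ) : G) = φ p := rfl

/-- **The corestriction has DENSE range — for EVERY continuous `φ`.** [cite: MochizukiSemiAnbd2006, Def 3.1 (i) p.33] -/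
theorem denseRange_toClosureRange : DenseRange (toClosureRange φ) := by
  rw [DenseRange, Topology.IsInducing.subtypeVal.dense_iff]
  intro x
  rw [← Set.range_comp]
  exact x.2

/-- `Ker(toClosureRange φ) = Ker φ`. [cite: MochizukiSemiAnbd2006, Def 3.1 (i) p.33] -/
theorem ker_toClosureRange : (toClosureRange φ).toMonoidHom.ker = φ.toMonoidHom.ker := by
  ext p
  rw [MonoidHom.mem_ker, MonoidHom.mem_ker]
  exact ⟨fun h => congrArg Subtype.val h, fun h => Subtype.ext h⟩

end ClosureRange

namespace BiKummerSetting

variable {K : Type u₀} [Field K] (X : SemiGraphs.TemperedArithmeticGroup.{u₀} K)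
  {G : Type u} [Group G] [TopologicalSpace G] [IsTopologicalGroup G] (hG : IsTempered G) (φ : X.Pi →ₜ* G)
  {D₀ : Type u₀} [Category.{v₀} D₀] {V : FrdIMonoidStub.{w}} {T₀ : RealifiedDivisorMonoids (D₀ := D₀) V}
  {VD : FrdICatStub.{u + 1, u, w} (ConnectedPart (BTemp (closureRange φ)))}
  (tf : TemperedFrobenioid T₀ (ConnectedPart (BTemp (closureRange φ))) VD) (hZ : tf.monoidType = MonoidType.Z)
  (hP : ∀ A : (ConnectedPart (BTemp (closureRange φ)))ᵒᵖ, IsPerfect (tf.Φ.carrier A))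
  (NH : Subgroup (Field.absoluteGaloisGroup K) → tf.category → ℕ+ → Prop) (M : OpenNormalSubgroup (closureRange φ))

/-- **The §4 setting over `B^temp(closure(Im φ))⁰` for an ARBITRARY continuous `φ : Π^tp_X → G` into a tempered group**, `A_⊙ :=
(closure(Im φ)/M, 0)` — NO density / surjectivity hypothesis: the corestriction is dense by construction.
[cite: MochizukiEtTh2009, Def 4.1 p.312–313 (PDF pp.86–87)] -/
def mkOfClosureRange : BiKummerSetting X T₀ (ConnectedPart (BTemp (closureRange φ))) VD :=
  mkOfDenseQuotientTemperoidQuot X (isTempered_closureRange φ hG) (toClosureRange φ) (denseRange_toClosureRange φ) tf hZ hP NH M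

/-- Its tempered Frobenioid is `tf` (definitionally). [cite: MochizukiEtTh2009, Def 4.1 p.312 (PDF p.86)] -/
theorem mkOfClosureRange_tf : (mkOfClosureRange X hG φ tf hZ hP NH M).tf = tf := rfl

/-- **`H_⊙ = φ⁻¹(M)`** read in `G` (membership). [cite: MochizukiEtTh2009, Def 4.1 p.312 (PDF p.86)] -/
theorem mem_Hodot_mkOfClosureRange_iff (g : X.Pi) :
    g ∈ (mkOfClosureRange X hG φ tf hZ hP NH M).Hodot ↔ (⟨φ g, apply_mem_closureRange φ g⟩ : closureRange φ) ∈ M :=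
  mem_Hodot_mkOfDenseQuotientTemperoidQuot_iff X (isTempered_closureRange φ hG) (toClosureRange φ) (denseRange_toClosureRange φ)
    tf hZ hP NH M g

/-- **Def. 4.1 (ii) naturality, open kernels, and `Ker φ ≤ H_⊙` — all THEOREMS, for every continuous `φ`.**
[cite: MochizukiEtTh2009, Def 4.1 (ii) p.313 (PDF p.87)] -/
theorem mkOfClosureRange_laws :
    (mkOfClosureRange X hG φ tf hZ hP NH M).GaloisSurjNatural ∧ (mkOfClosureRange X hG φ tf hZ hP NH M).IsOpenKerGaloisSurj ∧
      φ.toMonoidHom.ker ≤ (mkOfClosureRange X hG φ tf hZ hP NH M).Hodot := by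
  refine ⟨mkOfDenseQuotientTemperoid_galoisSurj_natural X (isTempered_closureRange φ hG) (toClosureRange φ)
      (denseRange_toClosureRange φ) tf hZ hP NH _ _ _,
    mkOfDenseQuotientTemperoid_isOpen_ker_galoisSurj X (isTempered_closureRange φ hG) (toClosureRange φ)
      (denseRange_toClosureRange φ) tf hZ hP NH _ _ _, ?_⟩
  rw [← ker_toClosureRange φ]
  exact ker_le_Hodot_mkOfDenseQuotientTemperoid X (isTempered_closureRange φ hG) (toClosureRange φ)
    (denseRange_toClosureRange φ) tf hZ hP NH _ _ _

/-- **The §5 binder `hH` (`Π^tp_Ÿ ⊆ H_⊙`) whenever `φ(ιX(Π^tp_Ÿ)) ⊆ M`.** [cite: MochizukiEtTh2009, §5 p.330 (PDF p.104)] -/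
theorem hH_mkOfClosureRange_of_forall_mem {P : Type*} [Group P] [TopologicalSpace P] (ιX : P ≃ₜ* X.Pi) (PiYdd : Subgroup P)
    (hM : ∀ y : P, y ∈ PiYdd → (⟨φ (ιX y), apply_mem_closureRange φ (ιX y)⟩ : closureRange φ) ∈ M) :
    ∀ y : P, y ∈ PiYdd → ιX y ∈ (mkOfClosureRange X hG φ tf hZ hP NH M).Hodot :=
  fun y hy => (mem_Hodot_mkOfClosureRange_iff X hG φ tf hZ hP NH M (ιX y)).2 (hM y hy)

include hG hZ hP NH M in
/-- **ENTRY THEOREM — non-vacuity in the hypothesis-free shape**: for EVERY continuous homomorphism `φ : Π^tp_X → G` into a tempered group,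
every tempered Frobenioid `tf` of monoid type `ℤ` with perfect `Φ` over `B^temp(closure(Im φ))⁰`, every `NH` and every open normal `M`, a §4
bi-Kummer setting with Def. 4.1 (ii) naturality, open kernels and `Ker φ ≤ H_⊙` EXISTS. [cite: MochizukiEtTh2009, Def 4.1 p.312–313 (PDF pp.86–87)] -/
theorem exists_biKummerSetting_closureRange :
    ∃ 𝔖 : BiKummerSetting X T₀ (ConnectedPart (BTemp (closureRange φ))) VD,
      𝔖.tf = tf ∧ 𝔖.GaloisSurjNatural ∧ 𝔖.IsOpenKerGaloisSurj ∧ φ.toMonoidHom.ker ≤ 𝔖.Hodot :=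
  ⟨mkOfClosureRange X hG φ tf hZ hP NH M, rfl, mkOfClosureRange_laws X hG φ tf hZ hP NH M⟩

end BiKummerSetting

end Literature.AnabelianGeometry.EtaleTheta

end
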